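import Summits.BirchSwinnertonDyer.BirchSwinnertonDyer.Theorems.ManinLocalTwoThreePinningKernel
import Summits.BirchSwinnertonDyer.BirchSwinnertonDyer.Theorems.ManinLocalTwoThreeEtaCertificateFast
import HarnessLib

/-!
# Sparse `η`-table certificates: skip the trivial multiplications of the table engine

Cell bsd-f2-manin, route `ManinLocalTwoThree` (cruxes C2 `ManinOddAtFour` stmt-22967 / C3 `ManinPrimeToThreeAtNine` stmt-22968),
an g55; a second drop-in accelerator for the kernel `η`-certificates of `…EtaCoefficientTables` / `…PinningKernel`
(`tables_of_etaCerts`), composed with p3's fast pentagonal Euler tables (`…EtaCertificateFast`).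

THE COST.  A certificate `mulList M tab (etaDenList M N r) = etaNumList M N r a` is checked by `decide +kernel`; the kernel's
work is essentially the number of truncated list products `mulList M` it evaluates (`≈ M²/2` integer products each):
`eulerProdList M s (divisorsList N)` multiplies once per DIVISOR `δ ∣ N` even when the exponent `s δ` is `0`
(a product by `oneList M`), and `powList M l s` costs `s` products for the `s`-th power (the first being `oneList M ⋆ l`).
For the numerator and denominator together that is `2·σ₀(N) + Σ_δ |r_δ| + 1` products per `η`-quotient; at level `144`
(`σ₀ = 15`, depth `M = 128`, `36` basis quotients with `Σ|r_δ| ≈ 12–20`) the `30` divisor products dominate (measured: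
`89 s` farm wall for a quotient with `Σ|r_δ| = 12`).

THE FIX.  `powListSparse` (`l¹ = l`, no product) and `eulerProdListSparse` (divisors with exponent `0` skipped; a tail of
exponent-`0` divisors costs nothing) model the SAME power series as the engine's lists — proved through the engine's own
`_spec` lemmas (`mulList_spec`, `oneList_spec`, `eulerScaledList_spec` via `eulerScaledListFast_eq`), not as list identities —
so `qExpansion_coeff_eq_of_etaCertificateSparse` has the engine's conclusion verbatim and `tables_of_etaCertsSparse` is the
kernel's `tables_of_etaCerts` with the sparse certificate as hypothesis: a level file states `hcertᵢ` over
`etaDenListSparse` / `etaNumListSparse` and feeds `tables_of_etaCertsSparse` where it fed `tables_of_etaCerts`.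
Cost per quotient drops to `#{δ : r_δ ≠ 0} + Σ_δ |r_δ| − 1` products.

HONEST FRAMING: a kernel-evaluation device; no new mathematics (`φ_δ⁰ = 1`, `l¹ = l`); nothing here proves C2, C3, Manin's
conjecture or BSD.  The four `def`s are computable list functions (data for `decide`), no named fact, no sorry.
[cite: Koehler2011, §2.1] [cite: HardyWright2008, §19.9 Thm 353]
-/

set_option autoImplicit false
-- lint-debt: the directory name repeats the summit name (sibling precedent `ManinLocalTwoThreeEtaCertificateFast.lean`)
set_option linter.dupNamespace false

noncomputable section

open Complex Filter Topology Set Function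
open UpperHalfPlane hiding I
open scoped Real Topology Manifold MatrixGroups ModularForm
open ModularForm CongruenceSubgroup PowerSeries Finset
open Literature.NumberTheory.ModularForms
open Literature.NumberTheory.EllipticCurves Literature.NumberTheory.EllipticCurves.ModularForms

namespace Summit.BirchSwinnertonDyer.BirchSwinnertonDyer.Theorems.ManinLocalTwoThree.BracketSturm

open Summit.BirchSwinnertonDyer.BirchSwinnertonDyer.Theorems.ManinLocalTwoThree.PinningKernel

/-! ## §1 The sparse lists -/

/-- Sparse truncated powers: `l⁰ = 1`, `l¹ = l` (no product), `l^{s+2} = l^{s+1} ⋆ l`. [folklore] -/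
def powListSparse (M : ℕ) (l : List ℤ) : ℕ → List ℤ
  | 0 => oneList M
  | 1 => l
  | s + 2 => mulList M (powListSparse M l (s + 1)) l

/-- Sparse Euler product over a divisor list: a divisor with exponent `0` is skipped, a last non-trivial factor is not
multiplied by `1`, and `φ_δ` is tabulated by the pentagonal number theorem (`eulerScaledListFast`). [cite: Koehler2011, §2.1] -/
def eulerProdListSparse (M : ℕ) (s : ℕ → ℕ) : List ℕ → List ℤ
  | [] => oneList M
  | δ :: L =>
    if s δ = 0 then eulerProdListSparse M s L
    else if ∀ δ' ∈ L, s δ' = 0 then powListSparse M (eulerScaledListFast M δ) (s δ)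
    else mulList M (powListSparse M (eulerScaledListFast M δ) (s δ)) (eulerProdListSparse M s L)

/-- Sparse NUMERATOR table of the `η`-quotient `r` with `q`-shift `a`. [cite: Koehler2011, §2.1] -/
def etaNumListSparse (M N : ℕ) (r : ℕ → ℤ) (a : ℕ) : List ℤ :=
  shiftList M a (eulerProdListSparse M (fun δ ↦ (r δ).toNat) (divisorsList N))

/-- Sparse DENOMINATOR table. [cite: Koehler2011, §2.1] -/
def etaDenListSparse (M N : ℕ) (r : ℕ → ℤ) : List ℤ :=
  eulerProdListSparse M (fun δ ↦ (-r δ).toNat) (divisorsList N)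

/-! ## §2 The sparse lists model the same series -/

/-- `powListSparse` models powers. [folklore] -/
theorem powListSparse_spec {M : ℕ} {l : List ℤ} {ψ : ℂ⟦X⟧} (h : ∀ n < M, ((l.getD n 0 : ℤ) : ℂ) = coeff n ψ) :
    ∀ (s n : ℕ), n < M → (((powListSparse M l s).getD n 0 : ℤ) : ℂ) = coeff n (ψ ^ s)
  | 0, n, hn => by rw [pow_zero, powListSparse]; exact oneList_spec M n hn
  | 1, n, hn => by rw [pow_one, powListSparse]; exact h n hn
  | s + 2, n, hn => by
    rw [powListSparse, pow_succ]
    have h1 := mulList_spec (Int.castRingHom ℂ) (ψ₁ := ψ ^ (s + 1)) (ψ₂ := ψ)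
      (fun m hm ↦ by rw [eq_intCast]; exact powListSparse_spec h (s + 1) m hm)
      (fun m hm ↦ by rw [eq_intCast]; exact h m hm) n hn
    rwa [eq_intCast] at h1

/-- A product of `φ_δ ^ 0`'s is `1`. [folklore] -/
theorem eulerProdFn_eq_one_of_forall (s : ℕ → ℕ) : ∀ L : List ℕ, (∀ δ ∈ L, s δ = 0) → eulerProdFn s L = 1
  | [], _ => by rw [eulerProdFn]
  | δ :: L, hL => by
    rw [eulerProdFn, hL δ (by simp), pow_zero, one_mul]
    exact eulerProdFn_eq_one_of_forall s L fun δ' hδ' ↦ hL δ' (by simp [hδ'])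

/-- The fast table of `φ_δ` models `𝓠(φ_δ)`. [cite: HardyWright2008, §19.9 Thm 353] -/
theorem eulerScaledListFast_spec {M δ : ℕ} (hδ : 0 < δ) :
    ∀ n < M, (((eulerScaledListFast M δ).getD n 0 : ℤ) : ℂ) = coeff n (qExpansion 1 (eulerFn δ)) := by
  rw [eulerScaledListFast_eq]; exact eulerScaledList_spec hδ

/-- **`eulerProdListSparse` is the table of `eulerProdFn` below `M`.** [folklore] -/
theorem eulerProdListSparse_spec (M : ℕ) (s : ℕ → ℕ) : ∀ L : List ℕ, (∀ δ ∈ L, 0 < δ) →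
    ∀ n < M, (((eulerProdListSparse M s L).getD n 0 : ℤ) : ℂ) = coeff n (qExpansion 1 (eulerProdFn s L))
  | [], _ => by
    intro n hn
    rw [eulerProdListSparse, eulerProdFn, show (1 : ℍ → ℂ) = fun _ ↦ 1 from rfl,
      QExpansionAlgebra.qExpansion_const 1 one_pos, coeff_C, oneList, getD_map_range _ hn]
    split_ifs <;> simp
  | δ :: L, hL => by
    intro n hn
    have hδ : 0 < δ := hL δ (by simp)
    have hL' : ∀ δ' ∈ L, 0 < δ' := fun δ' hδ' ↦ hL δ' (by simp [hδ'])
    rw [eulerProdListSparse]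
    by_cases h0 : s δ = 0
    · rw [if_pos h0, eulerProdFn, h0, pow_zero, one_mul]
      exact eulerProdListSparse_spec M s L hL' n hn
    rw [if_neg h0]
    by_cases hall : ∀ δ' ∈ L, s δ' = 0
    · rw [if_pos hall, eulerProdFn, eulerProdFn_eq_one_of_forall s L hall, mul_one,
        QExpansionAlgebra.qExpansion_pow_of_nice one_pos (nice_eulerFn hδ)]
      exact powListSparse_spec (eulerScaledListFast_spec hδ) (s δ) n hn
    rw [if_neg hall, eulerProdFn, QExpansionAlgebra.qExpansion_mul_of_nice one_pos
      (QExpansionAlgebra.nice_pow (nice_eulerFn hδ) _) (nice_eulerProdFn s L hL'),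
      QExpansionAlgebra.qExpansion_pow_of_nice one_pos (nice_eulerFn hδ)]
    have h1 := mulList_spec (Int.castRingHom ℂ) (ψ₁ := qExpansion 1 (eulerFn δ) ^ s δ)
      (ψ₂ := qExpansion 1 (eulerProdFn s L))
      (fun m hm ↦ by rw [eq_intCast]; exact powListSparse_spec (eulerScaledListFast_spec hδ) (s δ) m hm)
      (fun m hm ↦ by rw [eq_intCast]; exact eulerProdListSparse_spec M s L hL' m hm) n hn
    rwa [eq_intCast] at h1

/-! ## §3 The sparse certificate lemmas (same conclusions as `qExpansion_coeff_eq_of_etaCertificate`, `tables_of_etaCerts`) -/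

variable {N : ℕ} [NeZero N] {k : ℤ}

/-- **COEFFICIENT TABLE OF AN `η`-QUOTIENT from a SPARSE certificate, nice-function form.** [cite: Koehler2011, §2.1] -/
theorem qExpansion_coeff_eq_of_etaCertificateSparse_of_nice {F : ℍ → ℂ}
    (hF : Periodic (F ∘ ofComplex) 1 ∧ MDifferentiable 𝓘(ℂ) 𝓘(ℂ) F ∧ IsBoundedAtImInfty F) (r : ℕ → ℤ)
    (hE : ∀ τ : ℍ, F τ = etaQuotient N r τ) (a : ℕ) (hS : ∑ δ ∈ N.divisors, (δ : ℤ) * r δ = 24 * a) {M : ℕ}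
    (e : List ℤ) (hcert : mulList M e (etaDenListSparse M N r) = etaNumListSparse M N r a) :
    ∀ n < M, ((e.getD n 0 : ℤ) : ℂ) = (qExpansion 1 F).coeff n := by
  have hN : N ≠ 0 := NeZero.ne N
  have hpos : ∀ δ ∈ divisorsList N, 0 < δ := fun δ h ↦ pos_of_mem_divisorsList h
  set Den : ℍ → ℂ := eulerProdFn (fun δ ↦ (-r δ).toNat) (divisorsList N) with hDen
  set Num₀ : ℍ → ℂ := eulerProdFn (fun δ ↦ (r δ).toNat) (divisorsList N) with hNum₀
  have nDen := nice_eulerProdFn (fun δ ↦ (-r δ).toNat) (divisorsList N) hpos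
  have nNum₀ := nice_eulerProdFn (fun δ ↦ (r δ).toNat) (divisorsList N) hpos
  have hfun : F * Den = (fun τ : ℍ ↦ Periodic.qParam 1 (τ : ℂ)) ^ a * Num₀ := by
    funext τ
    rw [Pi.mul_apply, Pi.mul_apply, Pi.pow_apply, hE τ, hDen, hNum₀, eulerProdFn_divisorsList hN,
      eulerProdFn_divisorsList hN, etaQuotient_mul_prod_eq r a hS τ]
  have hq : qExpansion 1 F * qExpansion 1 Den = X ^ a * qExpansion 1 Num₀ := by
    rw [← QExpansionAlgebra.qExpansion_mul_of_nice one_pos hF nDen, hfun,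
      QExpansionAlgebra.qExpansion_mul_of_nice one_pos (QExpansionAlgebra.nice_pow nice_qParam a) nNum₀,
      QExpansionAlgebra.qExpansion_pow_of_nice one_pos nice_qParam, qExpansion_qParam]
  have hD₀ : coeff 0 (qExpansion 1 Den) = 1 := coeff_zero_qExpansion_eulerProdFn _ _ hpos
  intro n hn
  exact getD_eq_coeff_of_mulList_eq hq hD₀ (eulerProdListSparse_spec M _ _ hpos)
    (shiftList_spec a (eulerProdListSparse_spec M _ _ hpos)) hcert n hn

/-- **COEFFICIENT TABLE OF AN `η`-QUOTIENT FORM from a SPARSE certificate** (`E ∈ M_k(Γ₀(N))`). [cite: Koehler2011, §2.1] -/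
theorem qExpansion_coeff_eq_of_etaCertificateSparse (E : ModularForm (Gamma0 N) k) (r : ℕ → ℤ)
    (hE : ∀ τ : ℍ, E τ = etaQuotient N r τ) (a : ℕ) (hS : ∑ δ ∈ N.divisors, (δ : ℤ) * r δ = 24 * a) {M : ℕ}
    (e : List ℤ) (hcert : mulList M e (etaDenListSparse M N r) = etaNumListSparse M N r a) :
    ∀ n < M, ((e.getD n 0 : ℤ) : ℂ) = (qExpansion 1 ⇑E).coeff n :=
  qExpansion_coeff_eq_of_etaCertificateSparse_of_nice (nice_coe E) r hE a hS e hcert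

/-- **Cusp-form variant.** [cite: Koehler2011, §2.1] -/
theorem qExpansion_coeff_eq_of_etaCertificateSparse_cuspForm {k' : ℤ} (f : CuspForm (Gamma0 N) k') (r : ℕ → ℤ)
    (hf : ∀ τ : ℍ, f τ = etaQuotient N r τ) (a : ℕ) (hS : ∑ δ ∈ N.divisors, (δ : ℤ) * r δ = 24 * a) {M : ℕ}
    (e : List ℤ) (hcert : mulList M e (etaDenListSparse M N r) = etaNumListSparse M N r a) :
    ∀ n < M, ((e.getD n 0 : ℤ) : ℂ) = (qExpansion 1 ⇑f).coeff n :=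
  qExpansion_coeff_eq_of_etaCertificateSparse_of_nice (nice_coe_cuspForm f) r hf a hS e hcert

variable (N) in
/-- **Certified tables, sparse certificates** — the PINNING KERNEL's `tables_of_etaCerts` with the sparse certificate as
hypothesis: if `C i = ∏ η(δτ)^{r_δ}` with `Σ δ r_δ = 24 a_i` and `tabs i` passes the sparse convolution certificate to depth `K`,
then `tabs i [n] = aₙ(C i)` for `n < K`. [cite: Koehler2011, §2.1] -/
theorem tables_of_etaCertsSparse {g : ℕ} (K : ℕ) (r : Fin g → ℕ → ℤ) (a : Fin g → ℕ) (tabs : Fin g → List ℤ)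
    (C : Fin g → ModularForm (Gamma0 N) 2) (hC : ∀ i, ∀ τ : ℍ, C i τ = etaQuotient N (r i) τ)
    (hS : ∀ i, ∑ δ ∈ N.divisors, (δ : ℤ) * r i δ = 24 * a i)
    (hcert : ∀ i, mulList K (tabs i) (etaDenListSparse K N (r i)) = etaNumListSparse K N (r i) (a i)) :
    ∀ i, ∀ n < K, (((tabs i).getD n 0 : ℤ) : ℂ) = modCoefₗ N 2 n (C i) :=
  fun i n hn ↦ qExpansion_coeff_eq_of_etaCertificateSparse (C i) (r i) (hC i) (a i) (hS i) (tabs i) (hcert i) n hn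

/-! ## §4 Kernel sanity checks -/

/-- The sparse and the dense engine agree on `η(τ)²η(11τ)²` (level `11`) through degree `24` (kernel check). [folklore] -/
theorem etaNumListSparse_eleven :
    etaNumListSparse 24 11 (expFn [(1, 2), (11, 2)]) 1 = etaNumList 24 11 (expFn [(1, 2), (11, 2)]) 1 := by
  decide +kernel

/-- The sparse and the dense denominator tables agree on `η(4τ)⁻⁴η(8τ)⁸ …`-type data: level `32`, `r = (1,−2)(2,3)…`
through degree `24` (kernel check). [folklore] -/
theorem etaDenListSparse_thirtyTwo :
    etaDenListSparse 24 32 (expFn [(1, -2), (2, 3), (4, 1), (8, 3), (16, -2), (32, 1)]) =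
      etaDenList 24 32 (expFn [(1, -2), (2, 3), (4, 1), (8, 3), (16, -2), (32, 1)]) := by
  decide +kernel

end Summit.BirchSwinnertonDyer.BirchSwinnertonDyer.Theorems.ManinLocalTwoThree.BracketSturm

end
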